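import Mathlib
import HarnessLib
import Summits.AtomisticToContinuum.Statement

/-!
# Sketch — crux-ideate stmt-AtomisticToContinuum-12502 (NearConstantShortTimeHL), round 1, ideator 1

First lemmas of the three idea cards (statements only; they must elaborate, not be proved):

* `MeansPinLLN`      — card `means-pin-entropy` (TRANSFER: convergence of EXPECTATIONS of the three
                        fields at time `t` already gives the LLN at `t`, for exact local Gibbs data,
                        pre-shock, in the dilute band; general `(ε_N, n_N)` families as in the crux).
* `TiltRadius`       — card `tilt-radius` (the crux's `δ₀(M)` is an `N`-uniform analyticity radius of
                        the time-`t` one-body means in the tilt amplitude, general families).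
* `SmallTiltDomination` — card `small-tilt-domination` (static, provable now: a near-constant local
                        Gibbs DENSITY is bounded by `exp(C δ n)` times an INVARIANT global Gibbs density
                        at a slightly higher temperature).
-/

namespace Summit.AtomisticToContinuum.HydrodynamicLimit.Cruxes.NearConstantShortTimeHL.Sketch

open scoped BigOperators Topology Classical
open Filter Set MeasureTheory

/-- Card A (`means-pin-entropy`), first lemma / transfer statement `C⁺ → C`:
in the crux's own frame (general families, exact canonical local Gibbs data with LLN at `0`,
classical hs-Euler solution on `[0,T)`), for every `t < T` at which the solution has stayed in the
dilute band `ρσ³ < η₀` on `[0,t]`, CONVERGENCE OF THE EXPECTATIONS of the empirical density,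
momentum and energy fields at time `t` (tested against continuous `χ`) to the Euler values implies
their convergence IN PROBABILITY (the crux's conclusion at `t`). Mechanism: the exact finite-`N`
identity `H(f_t | ψ_λ)/n = [⟨λ₀,Ū₀⟩ − P_n(λ₀)] − [⟨λ, Ū^f_t⟩ − P_n(λ)]` (Liouville invariance +
log-linearity of hard-core local Gibbs densities in the empirical conserved fields) at the
Euler-matched reference `λ = λ^E_t`, static pressure convergence and pre-shock isentropy of
classical solutions give `H(f_t | ψ^E_t) = o(n)`, and static large deviations under `ψ^E_t`
finish. No near-constancy is needed for this step. -/
def MeansPinLLN : Prop :=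
  open Literature.MathematicalPhysics.KineticTheory Literature.Analysis.FluidPDE MeasureTheory Filter in
  ∃ η₀ : ℝ, 0 < η₀ ∧ ∀ (a₀ θ₀ : T3 → ℝ) (u₀ : T3 → V3), Continuous a₀ → Continuous θ₀ → Continuous u₀ →
    (∀ x, 0 < a₀ x) → (∀ x, 0 < θ₀ x) → ∃ σ₀ : ℝ, 0 < σ₀ ∧ ∀ σ : ℝ, 0 < σ → σ < σ₀ →
    ∀ (ε : ℕ → ℝ) (n : ℕ → ℕ), (∀ N, 0 < ε N) → Tendsto ε atTop (nhds 0) →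
    Tendsto (fun N => (n N : ℝ) * ε N ^ 3) atTop (nhds (σ ^ 3)) →
    ∀ (T : ℝ) (ρ θ : ℝ → T3 → ℝ) (u : ℝ → T3 → V3), IsHardSphereEulerSolution σ T ρ u θ →
    ∀ Φ : (N : ℕ) → HardSphereFlow (Torus.geometry (Fin 3)) (ε N) (n N),
    let P : (N : ℕ) → Measure (Config (n N) (Fin 3) T3) := fun N =>
      particleLaw (Φ N) (canonicalDensity (Torus.geometry (Fin 3)) (ε N) (n N) (localGibbsProfile a₀ u₀ θ₀));
    (∀ N, IsProbabilityMeasure (P N)) →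
    (∀ χ : T3 → ℝ, Continuous χ → ∀ δ : ℝ, 0 < δ →
      Tendsto (fun N => P N {z | δ < |empiricalDensityField ((Φ N).flow 0 z) χ - ∫ x, χ x * ρ 0 x|}) atTop (nhds 0) ∧
      Tendsto (fun N => P N {z | δ < ‖empiricalMomentumField ((Φ N).flow 0 z) χ - ∫ x, (χ x * ρ 0 x) • u 0 x‖}) atTop (nhds 0) ∧
      Tendsto (fun N => P N {z | δ < |empiricalEnergyField ((Φ N).flow 0 z) χ -
        ∫ x, χ x * totalEnergyDensity (ρ 0 x) (u 0 x) (θ 0 x)|}) atTop (nhds 0)) →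
    ∀ t ∈ Set.Ico 0 T, (∀ s ∈ Set.Icc 0 t, ∀ x, ρ s x * σ ^ 3 < η₀) →
    -- HYPOTHESIS C⁺: the EXPECTATIONS of the three fields at time `t` converge to the Euler values
    (∀ χ : T3 → ℝ, Continuous χ →
      (∀ N, Integrable (fun z => empiricalDensityField ((Φ N).flow t z) χ) (P N)) ∧
      (∀ N, Integrable (fun z => empiricalMomentumField ((Φ N).flow t z) χ) (P N)) ∧
      (∀ N, Integrable (fun z => empiricalEnergyField ((Φ N).flow t z) χ) (P N)) ∧
      Tendsto (fun N => ∫ z, empiricalDensityField ((Φ N).flow t z) χ ∂(P N)) atTop (nhds (∫ x, χ x * ρ t x)) ∧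
      Tendsto (fun N => ∫ z, empiricalMomentumField ((Φ N).flow t z) χ ∂(P N)) atTop
        (nhds (∫ x, (χ x * ρ t x) • u t x)) ∧
      Tendsto (fun N => ∫ z, empiricalEnergyField ((Φ N).flow t z) χ ∂(P N)) atTop
        (nhds (∫ x, χ x * totalEnergyDensity (ρ t x) (u t x) (θ t x)))) →
    -- CONCLUSION C: the crux's conclusion at time `t`
    ∀ χ : T3 → ℝ, Continuous χ → ∀ δ : ℝ, 0 < δ →
      Tendsto (fun N => P N {z | δ < |empiricalDensityField ((Φ N).flow t z) χ - ∫ x, χ x * ρ t x|}) atTop (nhds 0) ∧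
      Tendsto (fun N => P N {z | δ < ‖empiricalMomentumField ((Φ N).flow t z) χ - ∫ x, (χ x * ρ t x) • u t x‖}) atTop (nhds 0) ∧
      Tendsto (fun N => P N {z | δ < |empiricalEnergyField ((Φ N).flow t z) χ -
        ∫ x, χ x * totalEnergyDensity (ρ t x) (u t x) (θ t x)|}) atTop (nhds 0)

/-- Card B (`tilt-radius`), first lemma: `N`-UNIFORM ANALYTICITY RADIUS of the time-`t` one-body
means in the tilt amplitude at the invariant law, for GENERAL `(ε_N, n_N)` families. For every
guard size `M` there are `r₀ > 0` and `C` such that for every constant reference state (activity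
`ā`, temperature `θ̄`, drift `ū`, all `M`-bounded), every continuous tilt DIRECTION `(α, w, ϑ)` of
sup-norm `≤ 1` (only the amplitude is restricted, never the shape or its gradients), small `σ`,
every admissible family and flow, every `t ≤ 1` and every continuous one-body observable `wObs` of
quadratic velocity growth: the finite-`N` mean of `wObs` at time `t` under the local Gibbs datum of
amplitude `d` is the restriction to real `d` of a function holomorphic and bounded by `C` on the
complex disc `|d| < r₀`, with `r₀, C` independent of `N` and of the direction. (Cauchy ⇒ the `k`-th
amplitude-derivative, = the `(k+1)`-point equilibrium space-time cumulant, is `≤ C k! r₀^{-k}`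
uniformly in `N`; the crux's `δ₀(M)` is any number `< r₀(M)`.) -/
def TiltRadius : Prop :=
  open Literature.MathematicalPhysics.KineticTheory Literature.Analysis.FluidPDE MeasureTheory Filter in
  ∀ M : ℝ, 1 ≤ M → ∃ r₀ : ℝ, 0 < r₀ ∧ r₀ ≤ 1 / 2 ∧ ∃ C : ℝ, ∀ (abar θbar : ℝ) (ubar : V3),
    M⁻¹ ≤ abar → abar ≤ M → M⁻¹ ≤ θbar → θbar ≤ M → ‖ubar‖ ≤ M →
    ∀ (α ϑ : T3 → ℝ) (w : T3 → V3), Continuous α → Continuous ϑ → Continuous w →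
    (∀ x, |α x| ≤ 1 ∧ |ϑ x| ≤ 1 ∧ ‖w x‖ ≤ 1) →
    ∃ σ₀ : ℝ, 0 < σ₀ ∧ ∀ σ : ℝ, 0 < σ → σ < σ₀ →
    ∀ (ε : ℕ → ℝ) (n : ℕ → ℕ), (∀ N, 0 < ε N) → Tendsto ε atTop (nhds 0) →
    Tendsto (fun N => (n N : ℝ) * ε N ^ 3) atTop (nhds (σ ^ 3)) →
    ∀ Φ : (N : ℕ) → HardSphereFlow (Torus.geometry (Fin 3)) (ε N) (n N),
    ∀ t ∈ Set.Icc (0 : ℝ) 1, ∀ wObs : T3 × V3 → ℝ, Continuous wObs → (∀ y, |wObs y| ≤ 1 + ‖y.2‖ ^ 2) →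
    ∀ N : ℕ, ∃ g : ℂ → ℂ, DifferentiableOn ℂ g (Metric.ball 0 r₀) ∧ (∀ ζ ∈ Metric.ball (0 : ℂ) r₀, ‖g ζ‖ ≤ C) ∧
      ∀ d : ℝ, |d| < r₀ →
        g (d : ℂ) = ((∫ z, (∫ y, wObs y ∂(empiricalMeasure ((Φ N).flow t z)))
          ∂(particleLaw (Φ N) (canonicalDensity (Torus.geometry (Fin 3)) (ε N) (n N)
            (localGibbsProfile (fun x => abar * Real.exp (d * α x)) (fun x => ubar + d • w x)
              (fun x => θbar * (1 + d * ϑ x))))) : ℝ) : ℂ)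

/-- Card C (`small-tilt-domination`), first lemma (STATIC, provable now): a local Gibbs density whose
profiles are `δ`-close to constants `(ā, ū, θ̄)` — `|log(a₀/ā)| ≤ δ`, `‖u₀ − ū‖ ≤ δ`,
`|θ₀ − θ̄| ≤ δ θ̄` — is bounded POINTWISE by `exp(C δ n)` times the canonical density of the
CONSTANT profile `(ā e^{δ}, ū, θ̄(1+2δ))`, which is an invariant law of every hard-sphere flow
(drifted global Gibbs). The velocity Maxwellians need the higher temperature `θ̄(1+2δ)`
(`sup_v M_{θ₀,u₀}/M_{θ₊,ū} = (θ₊/θ₀)^{3/2} exp(|u₀−ū|²/(2(θ₊−θ₀)))`), the partition functions depend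
on the activity profile only (Maxwellians integrate to one). With `δ = C'(M) δ₀` along a guarded
near-constant Euler solution this is the domination `ψ^E_s ≤ e^{n C(M) δ₀} G₊` that converts an
equilibrium large-deviation RATE `c₀` into the crux's `δ₀(M) := c₀ / (2 C(M))`. -/
def SmallTiltDomination : Prop :=
  open Literature.MathematicalPhysics.KineticTheory Literature.Analysis.FluidPDE in
  ∀ M : ℝ, 1 ≤ M → ∃ C : ℝ, 0 < C ∧ ∀ δ : ℝ, 0 < δ → δ ≤ 1 / 2 →
    ∀ (abar θbar : ℝ) (ubar : V3), M⁻¹ ≤ abar → abar ≤ M → M⁻¹ ≤ θbar → θbar ≤ M → ‖ubar‖ ≤ M →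
    ∀ (a₀ θ₀ : T3 → ℝ) (u₀ : T3 → V3), Continuous a₀ → Continuous θ₀ → Continuous u₀ →
    (∀ x, 0 < a₀ x ∧ |Real.log (a₀ x / abar)| ≤ δ ∧ ‖u₀ x - ubar‖ ≤ δ ∧ |θ₀ x - θbar| ≤ δ * θbar) →
    ∀ (ε : ℝ), 0 < ε → ∀ (n : ℕ) (z : Config n (Fin 3) T3),
      canonicalDensity (Torus.geometry (Fin 3)) ε n (localGibbsProfile a₀ u₀ θ₀) z ≤
        Real.exp (C * δ * n) *
          canonicalDensity (Torus.geometry (Fin 3)) ε n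
            (localGibbsProfile (fun _ => abar * Real.exp δ) (fun _ => ubar) (fun _ => θbar * (1 + 2 * δ))) z

/-- Card C (`small-tilt-domination`), the EQUILIBRIUM INPUT it consumes (K-stub, typed for triage):
UNIFORM EXPONENTIAL TIGHTNESS of the centred weak-form MOMENTUM closure defect under the invariant
drifted global Gibbs law, for GENERAL `(ε_N, n_N)` families — the shape of
`SuperextensiveClosureCost.MomentumClosureCost` (stmt-14424: ball-averaged fields at radius
`n^{-1/4}`, speed cap `n^{1/24}` and packing cap `η₁` INSIDE the event) with the superexponential
`∀ M` replaced by ONE rate `c₀ > 0` that is UNIFORM IN THE DEFECT SIZE `δ` (the "near-jump" that the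
Osgood audit of the Gronwall requires), and uniform over the `M`-box of reference states. Implied by
the `∀ M` form; in substance the same bet (a finite-cost localized sustained defect kills both). -/
def EquilibriumClosureTightness : Prop :=
  open Literature.MathematicalPhysics.KineticTheory Literature.Analysis.FluidPDE Literature.Analysis.FunctionSpaces MeasureTheory Filter in
  ∃ η₁ : ℝ, 0 < η₁ ∧ ∀ M : ℝ, 1 ≤ M → ∃ c₀ : ℝ, 0 < c₀ ∧ ∀ (abar θe : ℝ) (ubar : V3),
    M⁻¹ ≤ abar → abar ≤ M → M⁻¹ ≤ θe → θe ≤ M → ‖ubar‖ ≤ M →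
    ∃ σ₀ : ℝ, 0 < σ₀ ∧ ∀ σ : ℝ, 0 < σ → σ < σ₀ →
    ∀ (ε : ℕ → ℝ) (n : ℕ → ℕ), (∀ N, 0 < ε N) → Tendsto ε atTop (nhds 0) →
    Tendsto (fun N => (n N : ℝ) * ε N ^ 3) atTop (nhds (σ ^ 3)) →
    ∀ Φ : (N : ℕ) → HardSphereFlow (Torus.geometry (Fin 3)) (ε N) (n N),
    ∀ (s τ : ℝ), 0 ≤ s → 0 < τ → s + τ ≤ 1 →
    ∀ ψ : ℝ → T3 → V3, Torus.IsSmoothSpaceTimeOn (Set.Icc s (s + τ)) ψ →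
    (∀ r ∈ Set.Icc s (s + τ), ∀ x, ‖ψ r x‖ ≤ 1 ∧ ‖Torus.timeDerivWithin (Set.Icc s (s + τ)) ψ r x‖ ≤ 1 ∧
      ∀ i, ‖Torus.partialDeriv i (ψ r) x‖ ≤ 1) →
    ∀ δ : ℝ, 0 < δ → ∀ᶠ N : ℕ in atTop,
      particleLaw (Φ N) (canonicalDensity (Torus.geometry (Fin 3)) (ε N) (n N)
          (localGibbsProfile (fun _ => abar) (fun _ => ubar) (fun _ => θe)))
        {z | let ℓ : ℝ := (n N : ℝ) ^ (-(1 / 4 : ℝ));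
             let χ : T3 → T3 → ℝ := fun x y => if Torus.euclidDist x y < ℓ then (4 / 3 * Real.pi * ℓ ^ 3)⁻¹ else 0;
             let ρ : ℝ → T3 → ℝ := fun r x => empiricalDensityField ((Φ N).flow r z) (χ x);
             let m : ℝ → T3 → V3 := fun r x => empiricalMomentumField ((Φ N).flow r z) (χ x);
             let e : ℝ → T3 → ℝ := fun r x => empiricalEnergyField ((Φ N).flow r z) (χ x);
             let p : ℝ → T3 → ℝ := fun r x => hsPressure σ (ρ r x) (2 / 3 * (e r x / ρ r x - ‖m r x‖ ^ 2 / (2 * ρ r x ^ 2)));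
             let Mt : ℝ → (T3 → V3) → ℝ := fun r g => ∑ j, (empiricalMomentumField ((Φ N).flow r z) (fun y => g y j)) j;
             (∀ r ∈ Set.Icc s (s + τ), ∀ i, ‖((Φ N).flow r z i).2‖ ≤ (n N : ℝ) ^ (1 / 24 : ℝ)) ∧
             (∀ r ∈ Set.Icc s (s + τ), ∀ x, ρ r x * σ ^ 3 ≤ η₁) ∧
             δ < |Mt (s + τ) (ψ (s + τ)) - Mt s (ψ s) - ∫ r in s..(s + τ),
               (Mt r (Torus.timeDerivWithin (Set.Icc s (s + τ)) ψ r) +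
                ∫ x, ((∑ i, ∑ j, (Torus.partialDeriv i (ψ r) x) j * (m r x i * m r x j / ρ r x)) +
                  p r x * Torus.divergence (ψ r) x))|}
        ≤ ENNReal.ofReal (Real.exp (-(c₀ * n N)))


end Summit.AtomisticToContinuum.HydrodynamicLimit.Cruxes.NearConstantShortTimeHL.Sketch
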